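import Mathlib
import HarnessLib
import Literature.Computability.AlgebraicComplexity.LaserValueCertificate
import Literature.Computability.AlgebraicComplexity.LaserSymmetrization
import Literature.Computability.AlgebraicComplexity.FlatteningBound
import Summits.MatrixMultiplication.MatrixMultiplication.Theorems.SoloInformedConverseDoorLimit

/-!
# OutsiderSandwich — laser values bound spectral points (decomp-mm lens-4, g17, bridge for `CouplingBenchmark`)

General bridge used by `Theorems/OutsiderSandwichCouplingBenchmark.lean`:

* `le_map_symm3_of_hasLaserValue` — if `V_ρ(t ⊗ t_C ⊗ t_{C²}) ≥ v` in Le Gall's sense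
  (`HasLaserValue ρ (symm3 t) v`, tree `LaserValue.lean`; `ρ > 0`) and `G` is a universal spectral
  point over `ℂ` with matrix exponent `ρ` (`G⟨M,M,M⟩ = M^ρ` for `M ≥ 1`), then
  `v ≤ G(t ⊗ t_C ⊗ t_{C²})`.  The symmetrisation `symm3 t` is relabelled into the literally
  variable-symmetric CYCLIC CARRIER `cyc3 t (x,y,z) = t(x₁,y₂,z₃)·t(y₁,z₂,x₃)·t(z₁,x₂,y₃)` on the
  common index type `ι × κ × μ` (`cyc3_restrictsTo_symm3`, `symm3_restrictsTo_cyc3`); the tree's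
  cube extraction `exists_polyDegeneratesTo_cube_of_hasLaserValue` (Schönhage / Alman 2021 Thm. 2.9)
  gives `cyc3(t)^{⊗N} ⊵ F ⊙ ⟨M,M,M⟩` with `u^N ≤ F·M^ρ` for every `0 < u < v`; `G` is monotone under
  degeneration (`ConverseDoorLimit.spectral_le_of_polyDegeneratesTo`), multiplicative and
  `G⟨F⟩ = F`, so `G(cyc3 t)^N ≥ u^N`, i.e. `G ≥ u` for all `u < v`.
* `asymptoticRank_rotate` — `R̃(t_C) = R̃(t)` (from `tensorRank_rotate`, powers commute with
  rotation definitionally).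
-/

noncomputable section

namespace Summit.MatrixMultiplication.MatrixMultiplication.Theorems.OutsiderSandwichLaserBridge

open Literature.Computability.AlgebraicComplexity
open Literature.Barriers.MatrixMultiplication (PolyDegeneratesTo IsVariableSymmetric)

/-! ## 1. The cyclic carrier of `t ⊗ t_C ⊗ t_{C²}` -/

section Bridge

variable {ι κ μ : Type}

/-- The **cyclic carrier** of `t`: `cyc3 t (x,y,z) = t(x₁,y₂,z₃) · t(y₁,z₂,x₃) · t(z₁,x₂,y₃)` on the
common index type `ι × κ × μ` — a relabelling of `symm3 t = t ⊗ t_C ⊗ t_{C²}` which is literally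
variable-symmetric (invariant under the cyclic shift of its three arguments). -/
def cyc3 (t : ι → κ → μ → ℂ) : ι × κ × μ → ι × κ × μ → ι × κ × μ → ℂ :=
  fun x y z => t x.1 y.2.1 z.2.2 * t y.1 z.2.1 x.2.2 * t z.1 x.2.1 y.2.2

/-- `cyc3 t` is variable-symmetric. -/
theorem isVariableSymmetric_cyc3 (t : ι → κ → μ → ℂ) : IsVariableSymmetric (cyc3 t) := by
  intro x y z
  simp only [cyc3]
  ring

/-- Relabelling of the second leg `κ × μ × ι ≃ ι × κ × μ`, `y ↦ (y₃, y₁, y₂)`. -/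
def toCyc₂ : κ × μ × ι ≃ ι × κ × μ where
  toFun y := (y.2.2, y.1, y.2.1)
  invFun x := (x.2.1, x.2.2, x.1)
  left_inv _ := rfl
  right_inv _ := rfl

/-- Relabelling of the third leg `μ × ι × κ ≃ ι × κ × μ`, `z ↦ (z₂, z₃, z₁)`. -/
def toCyc₃ : μ × ι × κ ≃ ι × κ × μ where
  toFun z := (z.2.1, z.2.2, z.1)
  invFun x := (x.2.2, x.1, x.2.1)
  left_inv _ := rfl
  right_inv _ := rfl

/-- `symm3 t` is the pull-back of `cyc3 t` along `id × toCyc₂ × toCyc₃`. -/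
theorem symm3_eq_cyc3 (t : ι → κ → μ → ℂ) :
    symm3 t = fun x y z => cyc3 t x (toCyc₂ y) (toCyc₃ z) := by
  funext x y z
  simp only [symm3_apply, cyc3, toCyc₂, toCyc₃, Equiv.coe_fn_mk]
  ring

/-- `cyc3 t ≥ symm3 t`. -/
theorem cyc3_restrictsTo_symm3 [Fintype ι] [Fintype κ] [Fintype μ] [DecidableEq ι] [DecidableEq κ]
    [DecidableEq μ] (t : ι → κ → μ → ℂ) : TensorRestrictsTo (cyc3 t) (symm3 t) := by
  rw [symm3_eq_cyc3]
  exact tensorRestrictsTo_precomp _ _ _ _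

/-- `symm3 t ≥ cyc3 t`. -/
theorem symm3_restrictsTo_cyc3 [Fintype ι] [Fintype κ] [Fintype μ] [DecidableEq ι] [DecidableEq κ]
    [DecidableEq μ] (t : ι → κ → μ → ℂ) : TensorRestrictsTo (symm3 t) (cyc3 t) := by
  rw [symm3_eq_cyc3]
  exact tensorRestrictsTo_of_reindex (cyc3 t) (Equiv.refl _) toCyc₂ toCyc₃

/-- **Values bound spectral points** (the bridge from Le Gall's value to the asymptotic spectrum):
if `V_ρ(t ⊗ t_C ⊗ t_{C²}) ≥ v` (`HasLaserValue ρ (symm3 t) v`, `ρ > 0`) and `G` is a universal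
spectral point whose restriction to matrix multiplication has exponent `ρ`
(`G⟨M,M,M⟩ = M^ρ`), then `v ≤ G(t ⊗ t_C ⊗ t_{C²})`.  Proof: pass to the variable-symmetric
carrier `cyc3 t ≅ symm3 t`, extract cubes `cyc3(t)^{⊗N} ⊵ F ⊙ ⟨M,M,M⟩` with `u^N ≤ F M^ρ` for every
`u < v` (`exists_polyDegeneratesTo_cube_of_hasLaserValue`), and evaluate `G`
(monotone under degeneration, multiplicative, `G⟨F⟩ = F`). -/
theorem le_map_symm3_of_hasLaserValue [Fintype ι] [Fintype κ] [Fintype μ] [DecidableEq ι]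
    [DecidableEq κ] [DecidableEq μ] (t : ι → κ → μ → ℂ) {G : SpectralMap ℂ}
    (hG : IsUniversalSpectralPoint ℂ G) {ρ : ℝ} (hρ : 0 < ρ)
    (hGρ : ∀ M : ℕ, 1 ≤ M → G (matMulTensor ℂ M M M) = (M : ℝ) ^ ρ)
    {v : ℝ} (hv : HasLaserValue ρ (symm3 t) v) : v ≤ G (symm3 t) := by
  classical
  have hge : G (cyc3 t) ≤ G (symm3 t) := hG.mono _ _ (symm3_restrictsTo_cyc3 t)
  refine le_trans ?_ hge
  by_contra hlt
  push Not at hlt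
  have h0 : 0 ≤ G (cyc3 t) := hG.nonneg _
  set u : ℝ := (G (cyc3 t) + v) / 2 with hu
  have hu0 : 0 < u := by rw [hu]; linarith
  have huv : u < v := by rw [hu]; linarith
  have hGu : G (cyc3 t) < u := by rw [hu]; linarith
  have hT : TensorRestrictsTo (kroneckerPow (cyc3 t) 1) (symm3 t) :=
    (tensorRestrictsTo_kroneckerPow_one _).trans (cyc3_restrictsTo_symm3 t)
  obtain ⟨N, F, M, hN, hF, hM, hdeg, hb⟩ :=
    exists_polyDegeneratesTo_cube_of_hasLaserValue (isVariableSymmetric_cyc3 t) hT hρ hv hu0 huv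
  have h1 : G (kroneckerTensor (unitTensor ℂ F) (matMulTensor ℂ M M M)) ≤
      G (kroneckerPow (cyc3 t) (1 * N)) :=
    ConverseDoorLimit.spectral_le_of_polyDegeneratesTo hG hdeg
  rw [hG.map_kronecker, hG.map_unitTensor, hGρ M hM, hG.map_kroneckerPow, one_mul] at h1
  have h2 : u ^ N ≤ G (cyc3 t) ^ N := hb.trans h1
  have h3 : G (cyc3 t) ^ N < u ^ N := pow_lt_pow_left₀ hGu h0 (by omega)
  exact absurd h2 (not_le.2 h3)

end Bridge

/-! ## 2. Rotation invariance of the asymptotic rank -/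

section Rotate

/-- Powers commute with rotation (definitionally). -/
theorem kroneckerPow_rotate {ι κ μ : Type} (t : ι → κ → μ → ℂ) (N : ℕ) :
    kroneckerPow (rotate t) N = rotate (kroneckerPow t N) := by
  funext b c a
  rfl

/-- **`R̃(t_C) = R̃(t)`**: the asymptotic rank is invariant under rotation of the legs. -/
theorem asymptoticRank_rotate {ι κ μ : Type} [Fintype ι] [Fintype κ] [Fintype μ]
    (t : ι → κ → μ → ℂ) :
    asymptoticRank (rotate t) = asymptoticRank t := by
  simp only [asymptoticRank, kroneckerPow_rotate, tensorRank_rotate]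

end Rotate

end Summit.MatrixMultiplication.MatrixMultiplication.Theorems.OutsiderSandwichLaserBridge
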